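import Mathlib
import Summits.AnomalousDissipation.AnomalousDissipation.Theses.DyadicWallCascade
import Summits.AnomalousDissipation.AnomalousDissipation.Theorems.HalfSpaceHierarchy.Negative.OneSigned
import Summits.AnomalousDissipation.AnomalousDissipation.Theorems.HalfSpaceHierarchy.Negative.Columnar

/-!
# No pressureless (free-streaming) half-space hierarchy
# (negative lemma for the crux `DyadicWallCascade.HalfSpaceHierarchy`, stmt-AnomalousDissipation-18627)

Refuter file, Negative lane (D-0016), route `DyadicWallCascade` of `Summits/AnomalousDissipation`;
cdisprove seat `refuter-cdisprove-stmt-AnomalousDissipation-18627-0`.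

`not_pressurelessHalfSpaceHierarchy`: the crux body (verbatim) together with "`∇Q = 0` on the open
half-space" (so the Euler clause becomes free streaming, `DV · V = 0`) is FALSE.  Unlike the other
negative lemmas of this directory, the proof USES the expanding renormalisation `x ↦ 2x` of the
crux (census T1 (iii), the Livšic/doubling-map structure) as an obstruction:

1. `freeStream_const_backward` — Grönwall: with `DV · V = 0`, `V` is constant on the backward ray
   `X + T V(X)`, `T ≤ 0`, from any point with `V₃ ≤ 0` (the deviation solves a linear ODE with zero
   data; `norm_le_gronwallBound_of_norm_deriv_right_le`).
2. If some point of `{z = 1}` has velocity `v` with `v₃ < 0`, the backward ray from any point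
   `(q, 1)` of the closed level set `S = {q : V(q,1) = v}` reaches height `2` at `(q + P, 2)`,
   `P = v_h / v₃`; integer translates at height `2` (`periodic_int_shifts`) and the dilation
   `X ↦ X/2` put `(q + P + n)/2` in `S` for every `n ∈ ℤ²` — `S` is stable under the four inverse
   branches of the expanding torus map `q ↦ 2q − P`.
3. Iterating from `q₀`, `S` contains a translate of every lattice `2^{-k} ℤ²`, hence is dense, hence
   (continuity) the whole plane: `V ≡ v` on `{z = 1}`, and the zero-mass-flux clause gives
   `v₃ = 0` — contradiction.
4. Otherwise `V₃ ≥ 0` on the flux square and `not_oneSignedFluxHalfSpaceHierarchy` (landed) ends it.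

Reading for constructions: every witness carries a genuinely non-trivial pressure field — the
cascade is held together by pressure forces at every octave (no ballistic/free-streaming legs
through a full octave); and the density-of-backward-orbits mechanism of steps 2–3 applies to ANY
design in which a velocity value is transported rigidly from height `1` to height `2`.
-/

open scoped BigOperators Topology InnerProductSpace
open Filter Set MeasureTheory

-- `Summit.<Summit>.<Problem>` is the tree's mandated summit-side namespace (CONVENTIONS §2); for this
-- single-conjunct summit the two coincide, so the duplicate is deliberate.
set_option linter.dupNamespace false

namespace Summit.AnomalousDissipation.AnomalousDissipation.Theorems

namespace HalfSpaceHierarchyNegative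

/-- **Free streaming is straight.**  If `V` is `C^∞` on the open half-space and `DV(Y) · V(Y) = 0`
there (pressureless steady Euler), then `V` is constant along the backward ray `X + T • V X`,
`T ≤ 0`, from any point `X` of the half-space with `V₃(X) ≤ 0` (the ray stays in the half-space).
Proof: `f(s) = V(X - s V(X)) - V(X)` solves the linear ODE `f' = DV · f` with `f(0) = 0`, so
`f ≡ 0` by Grönwall. [folklore] -/
theorem freeStream_const_backward {V : EuclideanSpace ℝ (Fin 3) → EuclideanSpace ℝ (Fin 3)}
    (hVs : ContDiffOn ℝ ((⊤ : ℕ∞) : WithTop ℕ∞) V {X : EuclideanSpace ℝ (Fin 3) | 0 < X 2})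
    (hfree : ∀ Y : EuclideanSpace ℝ (Fin 3), 0 < Y 2 → fderiv ℝ V Y (V Y) = 0)
    (X : EuclideanSpace ℝ (Fin 3)) (hX : 0 < X 2) (hV3 : (V X) 2 ≤ 0) (T : ℝ) (hT : T ≤ 0) :
    V (X + T • V X) = V X := by
  set H : Set (EuclideanSpace ℝ (Fin 3)) := {X | 0 < X 2} with hH
  have hHopen : IsOpen H :=
    isOpen_lt continuous_const (PiLp.continuous_apply 2 (fun _ : Fin 3 => ℝ) (2 : Fin 3))
  -- the backward ray, parametrised by `s = -t ≥ 0`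
  set ψ : ℝ → EuclideanSpace ℝ (Fin 3) := fun s => X + (-s) • V X with hψ
  have hψH : ∀ s : ℝ, 0 ≤ s → ψ s ∈ H := by
    intro s hs
    simp only [hH, hψ, Set.mem_setOf_eq, PiLp.add_apply, PiLp.smul_apply, smul_eq_mul]
    nlinarith
  have hψc : Continuous ψ := by
    simp only [hψ]; fun_prop
  -- a bound on `DV` along the compact segment
  have hDc : ContinuousOn (fun Y => fderiv ℝ V Y) H :=
    hVs.continuousOn_fderiv_of_isOpen hHopen (by simp)
  set S : ℝ := -T with hS
  have hS0 : 0 ≤ S := by linarith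
  have hseg : IsCompact (ψ '' Set.Icc 0 S) := isCompact_Icc.image hψc
  have hsegH : ψ '' Set.Icc 0 S ⊆ H := by
    rintro _ ⟨s, hs, rfl⟩; exact hψH s hs.1
  obtain ⟨K, hK⟩ := hseg.exists_bound_of_continuousOn (hDc.mono hsegH)
  -- the deviation `f`
  set f : ℝ → EuclideanSpace ℝ (Fin 3) := fun s => V (ψ s) - V X with hf
  have hVd : ∀ Y ∈ H, DifferentiableAt ℝ V Y := fun Y hY =>
    (hVs.differentiableOn (by simp) Y hY).differentiableAt (hHopen.mem_nhds hY)
  have hderiv : ∀ s : ℝ, 0 ≤ s → HasDerivAt f (fderiv ℝ V (ψ s) (-(V X))) s := by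
    intro s hs
    have hℓ : HasDerivAt ψ (-(V X)) s := by
      have : HasDerivAt (fun r : ℝ => X + (-r) • V X) ((-1 : ℝ) • V X) s := by
        simpa using (((hasDerivAt_id s).neg).smul_const (V X)).const_add X
      simpa [hψ] using this
    have h1 : HasDerivAt (fun r => V (ψ r)) (fderiv ℝ V (ψ s) (-(V X))) s :=
      (hVd _ (hψH s hs)).hasFDerivAt.comp_hasDerivAt s hℓ
    simpa [hf] using h1.sub_const (V X)
  have hcont : ContinuousOn f (Set.Icc 0 S) := by
    intro s hs
    exact (hderiv s hs.1).continuousAt.continuousWithinAt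
  have hbound : ∀ s ∈ Set.Ico 0 S, ‖fderiv ℝ V (ψ s) (-(V X))‖ ≤ K * ‖f s‖ + 0 := by
    intro s hs
    have hkey : fderiv ℝ V (ψ s) (-(V X)) = fderiv ℝ V (ψ s) (f s) := by
      have h0 := hfree (ψ s) (hψH s hs.1)
      have : -(V X) = f s - V (ψ s) := by simp [hf]
      rw [this, map_sub, h0, sub_zero]
    rw [hkey, add_zero]
    exact le_trans ((fderiv ℝ V (ψ s)).le_opNorm (f s))
      (mul_le_mul_of_nonneg_right (hK _ ⟨s, ⟨hs.1, hs.2.le⟩, rfl⟩) (norm_nonneg _))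
  have hG := norm_le_gronwallBound_of_norm_deriv_right_le (f := f)
    (f' := fun s => fderiv ℝ V (ψ s) (-(V X))) (δ := 0) (K := K) (ε := 0) (a := 0) (b := S)
    hcont (fun s hs => (hderiv s hs.1).hasDerivWithinAt) (by simp [hf, hψ]) hbound
  have hfS : f S = 0 := by
    have := hG S ⟨hS0, le_rfl⟩
    rw [sub_zero, gronwallBound_ε0_δ0] at this
    exact norm_le_zero_iff.mp this
  have : V (ψ S) = V X := sub_eq_zero.mp hfS
  simpa [hψ, hS] using this

/-- Band periodicity iterated: integer horizontal shifts at any height `1 ≤ h ≤ 2`. [folklore] -/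
theorem periodic_int_shifts {V : EuclideanSpace ℝ (Fin 3) → EuclideanSpace ℝ (Fin 3)}
    (hperV : ∀ X : EuclideanSpace ℝ (Fin 3), 1 ≤ X 2 → X 2 ≤ 2 →
      V (X + EuclideanSpace.single 0 1) = V X ∧ V (X + EuclideanSpace.single 1 1) = V X)
    (a b h : ℝ) (hh1 : 1 ≤ h) (hh2 : h ≤ 2) (m : ℤ × ℤ) :
    V !₂[a + m.1, b + m.2, h] = V !₂[a, b, h] := by
  have hz : ∀ a' b' : ℝ, (!₂[a', b', h] : EuclideanSpace ℝ (Fin 3)) 2 = h := by intro a' b'; simp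
  have h0 : ∀ (a' b' : ℝ) (k : ℤ), V !₂[a' + k, b', h] = V !₂[a', b', h] := by
    intro a' b' k
    induction k using Int.induction_on with
    | zero => simp
    | succ k ih =>
      have : (!₂[a' + ((k : ℤ) + 1 : ℤ), b', h] : EuclideanSpace ℝ (Fin 3))
          = !₂[a' + ((k : ℤ) : ℝ), b', h] + EuclideanSpace.single (0 : Fin 3) (1 : ℝ) := by
        ext i; fin_cases i <;> simp
        ring
      rw [this, (hperV _ (by rw [hz]; exact hh1) (by rw [hz]; exact hh2)).1, ih]
    | pred k ih =>
      have : (!₂[a' + ((-(k : ℤ)) : ℤ), b', h] : EuclideanSpace ℝ (Fin 3))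
          = !₂[a' + ((-(k : ℤ) - 1 : ℤ)), b', h] + EuclideanSpace.single (0 : Fin 3) (1 : ℝ) := by
        ext i; fin_cases i <;> simp
        ring
      rw [← ih, this, (hperV _ (by rw [hz]; exact hh1) (by rw [hz]; exact hh2)).1]
  have h1 : ∀ (a' b' : ℝ) (k : ℤ), V !₂[a', b' + k, h] = V !₂[a', b', h] := by
    intro a' b' k
    induction k using Int.induction_on with
    | zero => simp
    | succ k ih =>
      have : (!₂[a', b' + ((k : ℤ) + 1 : ℤ), h] : EuclideanSpace ℝ (Fin 3))
          = !₂[a', b' + ((k : ℤ) : ℝ), h] + EuclideanSpace.single (1 : Fin 3) (1 : ℝ) := by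
        ext i; fin_cases i <;> simp
        ring
      rw [this, (hperV _ (by rw [hz]; exact hh1) (by rw [hz]; exact hh2)).2, ih]
    | pred k ih =>
      have : (!₂[a', b' + ((-(k : ℤ)) : ℤ), h] : EuclideanSpace ℝ (Fin 3))
          = !₂[a', b' + ((-(k : ℤ) - 1 : ℤ)), h] + EuclideanSpace.single (1 : Fin 3) (1 : ℝ) := by
        ext i; fin_cases i <;> simp
        ring
      rw [← ih, this, (hperV _ (by rw [hz]; exact hh1) (by rw [hz]; exact hh2)).2]
  rw [h1, h0]

end HalfSpaceHierarchyNegative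

open HalfSpaceHierarchyNegative in
/-- **No pressureless half-space hierarchy** (refutes the strengthening "crux ∧ `∇Q = 0` on the
half-space" of `DyadicWallCascade.HalfSpaceHierarchy`, stmt-AnomalousDissipation-18627: a free-streaming
cascade `(V·∇)V = 0` does not exist).  This is the first obstruction on this crux that USES the
expanding renormalisation `x ↦ 2x` (census T1 (iii)) rather than an identity:
if some point of the plane `z = 1` has `V₃ < 0` and velocity `v`, free streaming makes `V ≡ v` on
the backward ray, which reaches height `2` at the horizontal offset `P = v_h / v₃`; periodicity at
height `2` and the dilation `X ↦ X/2` then show that the closed set `S = {q : V(q, 1) = v}` is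
stable under the four inverse branches `q ↦ (q + P + n)/2`, `n ∈ ℤ²`, of an expanding torus map, so
it contains a translate of every lattice `2^{-k}ℤ²`, is dense, and is the whole plane: `V ≡ v` on
`{z = 1}`, contradicting zero mass flux (`v₃ < 0`).  Otherwise `V₃ ≥ 0` on the flux square and
`not_oneSignedFluxHalfSpaceHierarchy` applies.  Reading: every witness carries a non-trivial
pressure field — the cascade is held together by pressure forces at every scale; and the
density-of-backward-orbits mechanism is available whenever a velocity value is transported rigidly
to the next octave. [folklore] -/
theorem not_pressurelessHalfSpaceHierarchy :
    ¬ (∃ (V : EuclideanSpace ℝ (Fin 3) → EuclideanSpace ℝ (Fin 3)) (Q : EuclideanSpace ℝ (Fin 3) → ℝ) (C F : ℝ),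
        (let H : Set (EuclideanSpace ℝ (Fin 3)) := {X | 0 < X 2}
         let e : Fin 3 → EuclideanSpace ℝ (Fin 3) := fun i => EuclideanSpace.single i (1 : ℝ)
         let pt : ℝ × ℝ → EuclideanSpace ℝ (Fin 3) := fun q => !₂[q.1, q.2, (1 : ℝ)]
         ContDiffOn ℝ ((⊤ : ℕ∞) : WithTop ℕ∞) V H ∧ ContDiffOn ℝ ((⊤ : ℕ∞) : WithTop ℕ∞) Q H ∧
         (∀ X ∈ H, ‖V X‖ ≤ C ∧ |Q X| ≤ C) ∧ (∀ X ∈ H, ∑ i : Fin 3, (fderiv ℝ V X (e i)) i = 0) ∧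
         (∀ X ∈ H, (fderiv ℝ V X) (V X) + gradient Q X = 0) ∧
         (∀ X ∈ H, V ((2 : ℝ) • X) = V X ∧ Q ((2 : ℝ) • X) = Q X) ∧
         (∀ X : EuclideanSpace ℝ (Fin 3), 1 ≤ X 2 → X 2 ≤ 2 →
            V (X + e 0) = V X ∧ V (X + e 1) = V X ∧ Q (X + e 0) = Q X ∧ Q (X + e 1) = Q X) ∧
         (∫ q in Set.Icc (0 : ℝ) 1 ×ˢ Set.Icc (0 : ℝ) 1, (V (pt q)) 2 = 0) ∧ F ≠ 0 ∧
         (∫ q in Set.Icc (0 : ℝ) 1 ×ˢ Set.Icc (0 : ℝ) 1, (V (pt q)) 2 * (‖V (pt q)‖ ^ 2 / 2 + Q (pt q)) = F)) ∧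
        (∀ X : EuclideanSpace ℝ (Fin 3), 0 < X 2 → gradient Q X = 0)) := by
  rintro ⟨V, Q, C, F, hbody, hgrad⟩
  have hbody' := hbody
  simp only at hbody
  obtain ⟨hVs, _hQs, _hbdd, _hdiv, hEul, hdil, hper, hmass, _hF, _hflux⟩ := hbody
  by_cases hD : ∃ q₀ : ℝ × ℝ, (V !₂[q₀.1, q₀.2, (1 : ℝ)]) 2 < 0
  swap
  · push Not at hD
    exact not_oneSignedFluxHalfSpaceHierarchy ⟨V, Q, C, F, hbody', fun q _ => hD q⟩
  obtain ⟨q₀, hq₀⟩ := hD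
  have hperV : ∀ X : EuclideanSpace ℝ (Fin 3), 1 ≤ X 2 → X 2 ≤ 2 →
      V (X + EuclideanSpace.single 0 1) = V X ∧ V (X + EuclideanSpace.single 1 1) = V X :=
    fun X h1 h2 => ⟨(hper X h1 h2).1, (hper X h1 h2).2.1⟩
  -- free streaming
  have hfree : ∀ Y : EuclideanSpace ℝ (Fin 3), 0 < Y 2 → fderiv ℝ V Y (V Y) = 0 := by
    intro Y hY
    have := hEul Y hY
    rwa [hgrad Y hY, add_zero] at this
  set v : EuclideanSpace ℝ (Fin 3) := V !₂[q₀.1, q₀.2, (1 : ℝ)] with hv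
  have hv3 : v 2 < 0 := hq₀
  -- the horizontal offset reached at height 2 along the backward ray
  set P : ℝ × ℝ := (v 0 / v 2, v 1 / v 2) with hP
  -- closure rule: `V(q,1) = v ⇒ V((q + P + n)/2, 1) = v`
  have hrule : ∀ (q : ℝ × ℝ) (n : ℤ × ℤ), V !₂[q.1, q.2, (1 : ℝ)] = v →
      V !₂[(q.1 + P.1 + n.1) / 2, (q.2 + P.2 + n.2) / 2, (1 : ℝ)] = v := by
    intro q n hq
    have hX : (0 : ℝ) < (!₂[q.1, q.2, (1 : ℝ)] : EuclideanSpace ℝ (Fin 3)) 2 := by simp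
    have hT : (1 : ℝ) / v 2 ≤ 0 := by
      rw [one_div]; exact (inv_lt_zero.mpr hv3).le
    have hray := freeStream_const_backward hVs hfree _ hX (by rw [hq]; exact hv3.le) _ hT
    rw [hq] at hray
    have hZ : (!₂[q.1, q.2, (1 : ℝ)] : EuclideanSpace ℝ (Fin 3)) + (1 / v 2) • v
        = !₂[q.1 + P.1, q.2 + P.2, (2 : ℝ)] := by
      ext i; fin_cases i
      · simp [hP]; ring
      · simp [hP]; ring
      · simp [hv3.ne]
        try norm_num
    rw [hZ] at hray
    have hperZ : V !₂[q.1 + P.1 + n.1, q.2 + P.2 + n.2, (2 : ℝ)] = v := by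
      rw [periodic_int_shifts hperV _ _ _ (by norm_num) le_rfl n]
      exact hray
    have hhalf : V ((2 : ℝ) • (!₂[(q.1 + P.1 + n.1) / 2, (q.2 + P.2 + n.2) / 2, (1 : ℝ)] :
        EuclideanSpace ℝ (Fin 3))) = V !₂[(q.1 + P.1 + n.1) / 2, (q.2 + P.2 + n.2) / 2, (1 : ℝ)] :=
      (hdil _ (by simp)).1
    have h2X : ((2 : ℝ) • (!₂[(q.1 + P.1 + n.1) / 2, (q.2 + P.2 + n.2) / 2, (1 : ℝ)] :
        EuclideanSpace ℝ (Fin 3))) = !₂[q.1 + P.1 + n.1, q.2 + P.2 + n.2, (2 : ℝ)] := by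
      ext i; fin_cases i <;> simp <;> ring
    rw [← hhalf, h2X]
    exact hperZ
  -- iterate: a translate of every dyadic lattice lies in the level set
  have hiter : ∀ k : ℕ, ∃ c : ℝ × ℝ, ∀ m : ℤ × ℤ,
      V !₂[c.1 + m.1 / 2 ^ k, c.2 + m.2 / 2 ^ k, (1 : ℝ)] = v := by
    intro k
    induction k with
    | zero =>
      refine ⟨q₀, fun m => ?_⟩
      simp only [pow_zero, div_one]
      rw [periodic_int_shifts hperV _ _ _ le_rfl (by norm_num) m]
    | succ k ih =>
      obtain ⟨c, hc⟩ := ih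
      refine ⟨((c.1 + P.1) / 2, (c.2 + P.2) / 2), fun m => ?_⟩
      have := hrule (c.1 + m.1 / 2 ^ k, c.2 + m.2 / 2 ^ k) (0, 0) (hc m)
      simp only [Int.cast_zero, add_zero] at this
      have e1 : (c.1 + P.1) / 2 + (m.1 : ℝ) / 2 ^ (k + 1) = (c.1 + (m.1 : ℝ) / 2 ^ k + P.1) / 2 := by
        rw [pow_succ]; ring
      have e2 : (c.2 + P.2) / 2 + (m.2 : ℝ) / 2 ^ (k + 1) = (c.2 + (m.2 : ℝ) / 2 ^ k + P.2) / 2 := by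
        rw [pow_succ]; ring
      show V !₂[(c.1 + P.1) / 2 + (m.1 : ℝ) / 2 ^ (k + 1), (c.2 + P.2) / 2 + (m.2 : ℝ) / 2 ^ (k + 1), (1 : ℝ)] = v
      rw [e1, e2]
      exact this
  -- density: the level set is everything
  have hcont : Continuous fun q : ℝ × ℝ => V !₂[q.1, q.2, (1 : ℝ)] :=
    hVs.continuousOn.comp_continuous continuous_pt (fun q => by simp)
  have hall : ∀ q : ℝ × ℝ, V !₂[q.1, q.2, (1 : ℝ)] = v := by
    intro q
    choose c hc using hiter
    -- nearest lattice point below `q`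
    set r : ℕ → ℝ × ℝ := fun k =>
      ((c k).1 + (⌊(q.1 - (c k).1) * 2 ^ k⌋ : ℤ) / 2 ^ k,
       (c k).2 + (⌊(q.2 - (c k).2) * 2 ^ k⌋ : ℤ) / 2 ^ k) with hr
    have hrv : ∀ k, V !₂[(r k).1, (r k).2, (1 : ℝ)] = v := fun k =>
      hc k (⌊(q.1 - (c k).1) * 2 ^ k⌋, ⌊(q.2 - (c k).2) * 2 ^ k⌋)
    have hclose : ∀ (a ck : ℝ) (k : ℕ), |ck + (⌊(a - ck) * 2 ^ k⌋ : ℤ) / 2 ^ k - a| ≤ (1 / 2 : ℝ) ^ k := by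
      intro a ck k
      have h2k : (0 : ℝ) < 2 ^ k := by positivity
      set x : ℝ := (a - ck) * 2 ^ k with hx
      have heq : ck + ((⌊x⌋ : ℤ) : ℝ) / 2 ^ k - a = (((⌊x⌋ : ℤ) : ℝ) - x) / 2 ^ k := by
        rw [hx]; field_simp; ring
      have hfr : |((⌊x⌋ : ℤ) : ℝ) - x| ≤ 1 := by
        rw [show ((⌊x⌋ : ℤ) : ℝ) - x = -(Int.fract x) by rw [Int.fract]; ring, abs_neg,
          abs_of_nonneg (Int.fract_nonneg x)]
        exact (Int.fract_lt_one x).le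
      rw [heq, abs_div, abs_of_pos h2k, one_div_pow]
      exact div_le_div_of_nonneg_right hfr h2k.le
    have hgeom : Tendsto (fun k : ℕ => (1 / 2 : ℝ) ^ k) atTop (𝓝 0) :=
      tendsto_pow_atTop_nhds_zero_of_lt_one (by norm_num) (by norm_num)
    have h1 : Tendsto (fun k => (r k).1) atTop (𝓝 q.1) := by
      have hz : Tendsto (fun k => (r k).1 - q.1) atTop (𝓝 0) :=
        squeeze_zero_norm (fun k => by simpa [hr, Real.norm_eq_abs] using hclose q.1 (c k).1 k) hgeom
      have := hz.add_const q.1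
      simpa using this
    have h2 : Tendsto (fun k => (r k).2) atTop (𝓝 q.2) := by
      have hz : Tendsto (fun k => (r k).2 - q.2) atTop (𝓝 0) :=
        squeeze_zero_norm (fun k => by simpa [hr, Real.norm_eq_abs] using hclose q.2 (c k).2 k) hgeom
      have := hz.add_const q.2
      simpa using this
    have hrq : Tendsto r atTop (𝓝 q) := by
      have := h1.prodMk_nhds h2
      simpa using this
    have hlim := (hcont.tendsto q).comp hrq
    have hconstseq : (fun k => V !₂[(r k).1, (r k).2, (1 : ℝ)]) = fun _ => v := funext hrv
    have hlim' : Tendsto (fun _ : ℕ => v) atTop (𝓝 (V !₂[q.1, q.2, (1 : ℝ)])) := by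
      have : ((fun q : ℝ × ℝ => V !₂[q.1, q.2, (1 : ℝ)]) ∘ r) = fun _ => v := by
        funext k; exact hrv k
      rw [this] at hlim
      exact hlim
    exact (tendsto_nhds_unique tendsto_const_nhds hlim').symm
  -- zero mass flux forces `v₃ = 0`
  simp_rw [hall] at hmass
  rw [setIntegral_const, volReal_unitSq, one_smul] at hmass
  exact (ne_of_lt hv3) hmass

end Summit.AnomalousDissipation.AnomalousDissipation.Theorems
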